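import Literature.AlgebraicGeometry.HodgeTheory.WeilClassesFieldDecomposableIffLefschetzGroup
import Literature.AlgebraicGeometry.HodgeTheory.HodgeGroupSemisimpleOfNoTypeIVFactor
import Mathlib.LinearAlgebra.Matrix.Charpoly.Coeff
import HarnessLib

/-!
# `θ ≠ 0 ⟹` all non-zero classes of `W_F` are exceptional: the type-4 direction of Moonen–Zarhin's Criterion (2),
# on the carrier, for every complex abelian variety

Layer `Literature/AlgebraicGeometry/HodgeTheory`; THEOREMS ONLY (no definition, no named fact; D-0026 net debt 0).
Sequel of `WeilClassesFieldDecomposableIffLefschetzGroup` (Moonen–Zarhin's `G_div(X)(ℂ)` read as Milne's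
`S(A)(h)(ℂ) = unitaryCentralizerGroup A h` — the centralizer of ALL of `End⁰(X)` in `Sp(H¹, Q_h)`, a subgroup of
`G_div(X) := Gl_B(V) ∩ Sp(V, φ)` (`B ⊆ End⁰(X)` the subalgebra generated by the `†`-symmetric elements) and EQUAL
to it in the case of the print treated here, type 4 with `d ≥ 2` or `m ≥ 2`, where «`B = End⁰(X)`»; «all
non-zero classes of `W_F` exceptional ⟺ some `u ∈ S(A)(h)(ℂ)` has `det(u | V_ρ) ≠ 1»`) and of
`HodgeGroupSemisimpleOfNoTypeIVFactor` (the polarization form on `H¹(A(ℂ); ℂ)`).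

## The print

B. J. J. Moonen, Yu. G. Zarhin, *Weil classes on abelian varieties*, J. reine angew. Math. **496** (1998) =
arXiv:alg-geom/9612017 [MoonenZarhin1998WeilClasses], §1 Criterion (2) and its proof (held chunks p0003–p0004),
VERBATIM: «… or all non-zero classes in `W_F` are exceptional; this last possibility occurs precisely in the
following cases: […] `Y` is of Type 4 with `d ≥ 2` or `m ≥ 2` and the map `θ : E₋ ↪ End_F(V_X) —Tr_F→ F` is
non-zero. […] Next assume that `X` is of type 4 with either `m ≥ 2` or `d ≥ 2`. We have `F ⊆ B = End⁰(X)`. Since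
in this case `G_div(X)` is connected (see (Gdivprops)), it acts trivially on `W_F` if and only if the composition
`U_E = Z(G_div) ⊂ G_div(X) ↪ Gl_F(V_Y) —det_F→ F^*` is trivial. The torus `U_E` being connected, this is the case
if and only if the induced map on Lie algebras `θ : E₋ ↪ End_F(V_X) —Tr_F→ F` is zero.»

## What is proved — the direction «`θ ≠ 0` ⟹ exceptional», for EVERY `A` (no type hypothesis, no connectedness)

Carrier dictionary (as in the seat's files): `F = ℚ(φ)`, `P(φ) = 0`, `P ∈ ℤ[T]` monic irreducible of degree `e`,
`e · 2m = 2 dim A`; `V_ρ = ker(φ^* - ρ) ⊆ H¹(A(ℂ); ℂ)` for a complex root `ρ` (`= V_X ⊗_{F,σ} ℂ`, `σ(φ) = ρ`);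
`W_F ⊗ ℂ = weilClassesField A φ P (2m)`, `Dᵐ ⊗ ℂ = divisorClassesSpan A.X A.dim m`; `h` a polarization class
(rational, type `(1,1)`, hard Lefschetz, Hodge–Riemann positive on `H^{1,0}` — the output of
`HodgeGroupSemisimple.exists_polarizationClass`); `E ⊗ ℂ` on `H¹` = the span of the central pull-backs
`u^*` (`u^* ∈ C(A) ⊗ ℂ`, `E = Z(End⁰(A))`); the Rosati involution `†` = the `Q_h`-adjoint; `E₋ ⊗ ℂ` is spanned
by the `w = u^* - (u^*)†`; and the complexification of
`θ(α) = Tr_F(α; V_X)` at `σ` is the trace of `α` on `V_ρ`: **`θ_ρ(w) = Tr(w | V_ρ)`**.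

* §1 **The adjoint of a central pull-back**: if `Y' = (u^*)†` (`Q_h(u^* x, y) = Q_h(x, Y' y)`) then `Y'` commutes
  with every `φ^*` («`C(A)` is stable under `†`», Milne §1 p. 643; through Deligne I 3.4 for the adjoints of the
  `φ^*`), so `w = u^* - Y'` preserves every `V_ρ` (`sub_adjoint_mapsTo_eigenspace`).
* §2 **`θ_ρ(w) ≠ 0` ⟹ the centre of `S(A)(h)(ℂ)` acts non-trivially on `⋀ V_ρ`**: there is a CENTRAL
  `z ∈ S(A)(h)(ℂ)` with `det(z | V_ρ) ≠ 1` (`exists_mem_center_unitaryCentralizerGroup_detOnEigenspace_ne_one`): the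
  Cayley transforms `z_t = (1 + t w)(1 - t w)⁻¹` are central elements of `S(A)(h)(ℂ)` and
  `det(z_t | V_ρ) = det(1 + t w|V_ρ) / det(1 - t w|V_ρ)` is `≡ 1` in `t` only if `Tr(w | V_ρ) = 0` (compare the
  coefficients of `t` — Mathlib `Matrix.det_one_add_smul`: «the induced map on Lie algebras»).
* §3 **Criterion (2), type-4 direction**: if `θ_ρ(w) ≠ 0` for some central `u` and some root `ρ`, then
  **`W_F ⊗ ℂ ⊓ Dᵐ ⊗ ℂ = ⊥`** — all non-zero Weil classes relative to `F` are exceptional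
  (`weilClassesField_inf_divisorClassesSpan_eq_bot_of_trace_ne_zero`, through the tree's
  `weilClassesField_inf_divisorClassesSpan_eq_bot_iff_exists_detOnEigenspace_ne_one`); with Criterion (1)
  (`W_F` Hodge iff `n_ρ = n_ρ̄`) this is Moonen–Zarhin's «Hodge but exceptional» situation whenever the
  multiplicities are balanced.

* §4 (rider) «`C(A)` is stable under `†`» for the centre part, in full: the `Q_h`-adjoint of a central pull-back
  lies in `C(A) ⊗ ℂ` and is a `ℂ`-combination of central pull-backs (`adjoint_central_pullbackOne_mem_centralizerAlgebra`,
  `adjoint_central_pullbackOne_mem_span_central_pullbackOne`), so `w = u^* - (u^*)† ∈ E ⊗ ℂ` on the carrier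
  (`sub_adjoint_mem_span_central_pullbackOne`).

NOT here: the converse «exceptional ⟹ `θ ≠ 0`» for type 4 with `d ≥ 2` or `m ≥ 2` (it needs `G_div` CONNECTED and
`G_div = Z · [G_div, G_div]`, algebraic-group structure absent on the Tannaka-free carrier), Table 1, the types.

## References

* [MoonenZarhin1998WeilClasses] B. J. J. Moonen, Yu. G. Zarhin, *Weil classes on abelian varieties*,
  J. reine angew. Math. 496 (1998) = arXiv:alg-geom/9612017, §1 Criterion (2) and its proof, Lemma (1)
  (chunks p0002–p0004).
* [Milne1999LefschetzClasses] J. S. Milne, Duke Math. J. 96 (1999), §1 pp. 642–644 (`†`, `C(A)` `†`-stable, `S(A)`).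
* [Deligne1982HodgeCycles] P. Deligne, LNM 900 (1982), I Prop. 3.4.
* [LangeBirkenhake1992] H. Lange, Ch. Birkenhake, *Complex Abelian Varieties*, §5.1 (Rosati = adjoint).

## Provenance

Lane `lit-hodgefound` (Track 2, Layer A), prover seat `lit-hodgefound-p21` (generation 13), row g13-#5; sequel of
Q1913 and of g13-#2/#4 (`LefschetzGroupEndInvariantsCentre`, `LefschetzGroupCentreInfiniteOfTypeIVFactor`), whose
private Cayley construction is repeated here with the determinant bookkeeping.
-/

noncomputable section

namespace Literature.AlgebraicGeometry.HodgeTheory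

namespace LefschetzGroupTheta

open Module Polynomial

/-! ### Part 0. Linear algebra (private): adjoints, `det(1 ± tN)` and the trace, the Cayley element -/

section LinAlg

variable {V : Type*} [AddCommGroup V] [Module ℂ V]

/-- For an alternating form the adjoint relation can be read on either side. [folklore] -/
private theorem isAdj_apply_right {B : LinearMap.BilinForm ℂ V} (hBalt : ∀ x y, B y x = -B x y)
    {T T' : Module.End ℂ V} (h : ∀ x y, B (T' x) y = B x (T y)) (x y : V) :
    B (T x) y = B x (T' y) := by
  rw [hBalt y (T x), ← h, hBalt, neg_neg]

/-- The adjoint of `T` commutes with every isometry commuting with `T`. [folklore] -/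
private theorem isAdj_comm_of_isometry {B : LinearMap.BilinForm ℂ V} (hBnd : B.Nondegenerate)
    {T T' : Module.End ℂ V} (hadj : ∀ x y, B (T' x) y = B x (T y))
    {u : V ≃ₗ[ℂ] V} (hu : ∀ x y, B (u x) (u y) = B x y) (huT : ∀ x, u (T x) = T (u x)) (x : V) :
    u (T' x) = T' (u x) := by
  have key : ∀ y, B (T' (u x) - u (T' x)) y = 0 := fun y ↦ by
    obtain ⟨y', rfl⟩ : ∃ y', y = u y' := ⟨u.symm y, (u.apply_symm_apply y).symm⟩
    rw [map_sub, LinearMap.sub_apply, hadj, ← huT, hu, ← hadj, hu, sub_self]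
  exact (sub_eq_zero.1 (hBnd.1 _ key)).symm

/-- If a linear map commutes with a linear automorphism, it commutes with its inverse. [folklore] -/
private theorem symm_apply_comm {P : Module.End ℂ V} {e : V ≃ₗ[ℂ] V} (h : ∀ x, e (P x) = P (e x)) (x : V) :
    e.symm (P x) = P (e.symm x) := by
  rw [LinearEquiv.symm_apply_eq, h, LinearEquiv.apply_symm_apply]

/-- **`det(1 + tN) = det(1 - tN)` for infinitely many `t` forces `Tr N = 0`** (`N` an endomorphism of a
finite-dimensional complex vector space): both sides are polynomials in `t` with linear coefficients `± Tr N`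
(Mathlib `Matrix.det_one_add_smul`). [folklore] -/
private theorem trace_eq_zero_of_infinite_det_eq {U : Type*} [AddCommGroup U] [Module ℂ U] [FiniteDimensional ℂ U]
    (N : Module.End ℂ U)
    (hinf : Set.Infinite {t : ℂ | LinearMap.det (1 + t • N) = LinearMap.det (1 - t • N)}) :
    LinearMap.trace ℂ U N = 0 := by
  classical
  let b := Module.finBasis ℂ U
  set M : Matrix _ _ ℂ := LinearMap.toMatrix b b N with hM
  have hdet : ∀ (t : ℂ) (L : Module.End ℂ U) (M' : Matrix _ _ ℂ), LinearMap.toMatrix b b L = t • M' →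
      LinearMap.det (1 + L) = Matrix.det (1 + t • M') := by
    intro t L M' hL
    rw [← LinearMap.det_toMatrix b, map_add, LinearMap.toMatrix_one, hL]
  have hplus : ∀ t : ℂ, LinearMap.det (1 + t • N) = Matrix.det (1 + t • M) := fun t ↦
    hdet t _ _ (by rw [LinearEquiv.map_smul, hM])
  have hminus : ∀ t : ℂ, LinearMap.det (1 - t • N) = Matrix.det (1 + t • (-M)) := fun t ↦ by
    rw [sub_eq_add_neg, ← smul_neg]
    exact hdet t _ _ (by rw [LinearEquiv.map_smul, map_neg, hM])
  -- the two polynomials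
  set qp : ℂ[X] := (Matrix.det (1 + (X : ℂ[X]) • M.map C)).divX.divX with hqp
  set qm : ℂ[X] := (Matrix.det (1 + (X : ℂ[X]) • (-M).map C)).divX.divX with hqm
  set fp : ℂ[X] := C 1 + C M.trace * X + qp * X ^ 2 with hfp
  set fm : ℂ[X] := C 1 + C (-M).trace * X + qm * X ^ 2 with hfm
  have hfp_eval : ∀ t : ℂ, fp.eval t = Matrix.det (1 + t • M) := fun t ↦ by
    rw [Matrix.det_one_add_smul t M, hfp]
    simp only [eval_add, eval_mul, eval_C, eval_X, eval_pow]
    ring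
  have hfm_eval : ∀ t : ℂ, fm.eval t = Matrix.det (1 + t • (-M)) := fun t ↦ by
    rw [Matrix.det_one_add_smul t (-M), hfm]
    simp only [eval_add, eval_mul, eval_C, eval_X, eval_pow]
    ring
  have heq : fp = fm := by
    refine Polynomial.eq_of_infinite_eval_eq fp fm (hinf.mono fun t ht ↦ ?_)
    simp only [Set.mem_setOf_eq] at ht ⊢
    rw [hfp_eval, hfm_eval, ← hplus, ← hminus, ht]
  have hc1 : ∀ (a : ℂ) (q : ℂ[X]), (C 1 + C a * X + q * X ^ 2 : ℂ[X]).coeff 1 = a := fun a q ↦ by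
    rw [coeff_add, coeff_add, coeff_C, if_neg one_ne_zero, zero_add, coeff_C_mul, coeff_X_one, mul_one,
      coeff_mul_X_pow', if_neg (by norm_num), add_zero]
  have htr : M.trace = (-M).trace := by
    have e := congrArg (fun f : ℂ[X] ↦ f.coeff 1) heq
    simpa only [hfp, hfm, hc1] using e
  rw [Matrix.trace_neg] at htr
  have hM0 : M.trace = 0 := by linear_combination htr / 2
  rw [LinearMap.trace_eq_matrix_trace ℂ b, ← hM, hM0]

variable [FiniteDimensional ℂ V]

/-- **The Cayley element with non-trivial determinant on an invariant subspace.**  `B` a bilinear form, `w` a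
`B`-skew endomorphism commuting with a set `Pset` of endomorphisms and with a subgroup `S` of `GL(V)` containing every
`B`-isometry that commutes with `Pset`; `U ≤ V` a `w`-stable subspace with `Tr(w | U) ≠ 0`.  Then some Cayley transform
`z = (1 + t w)(1 - t w)⁻¹` is a central element of `S`, preserves `U`, and has `det(z | U) ≠ 1`. [folklore] -/
private theorem exists_mem_center_det_restrict_ne_one {B : LinearMap.BilinForm ℂ V} {w : Module.End ℂ V}
    (hskew : ∀ x y, B (w x) y = -B x (w y)) (Pset : Set (Module.End ℂ V)) (hwP : ∀ P ∈ Pset, ∀ x, P (w x) = w (P x))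
    (S : Subgroup (V ≃ₗ[ℂ] V)) (hSw : ∀ s ∈ S, ∀ x, s (w x) = w (s x))
    (hS : ∀ u : V ≃ₗ[ℂ] V, (∀ P ∈ Pset, ∀ x, u (P x) = P (u x)) → (∀ x y, B (u x) (u y) = B x y) → u ∈ S)
    (U : Submodule ℂ V) (hU : ∀ x ∈ U, w x ∈ U) (htr : LinearMap.trace ℂ U (w.restrict hU) ≠ 0) :
    ∃ (z : V ≃ₗ[ℂ] V) (hzS : z ∈ S), (⟨z, hzS⟩ : S) ∈ Subgroup.center S ∧
      (∀ P ∈ Pset, ∀ x, z (P x) = P (z x)) ∧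
      ∃ hzU : ∀ x ∈ U, (z : V →ₗ[ℂ] V) x ∈ U, LinearMap.det ((z : V →ₗ[ℂ] V).restrict hzU) ≠ 1 := by
  classical
  set Ep : ℂ → Module.End ℂ V := fun t ↦ 1 + t • w with hEp
  set Em : ℂ → Module.End ℂ V := fun t ↦ 1 - t • w with hEm
  have hEp_apply : ∀ t x, Ep t x = x + t • w x := fun t x ↦ rfl
  have hEm_apply : ∀ t x, Em t x = x - t • w x := fun t x ↦ rfl
  -- the restriction `N = w | U` and `Ep t | U = 1 + t N`, `Em t | U = 1 - t N`
  set N : Module.End ℂ U := w.restrict hU with hN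
  have hEpU : ∀ (t : ℂ) (x : V), x ∈ U → Ep t x ∈ U := fun t x hx ↦ by
    rw [hEp_apply]; exact U.add_mem hx (U.smul_mem t (hU x hx))
  have hEmU : ∀ (t : ℂ) (x : V), x ∈ U → Em t x ∈ U := fun t x hx ↦ by
    rw [hEm_apply]; exact U.sub_mem hx (U.smul_mem t (hU x hx))
  have hEp_restrict : ∀ t : ℂ, (Ep t).restrict (hEpU t) = 1 + t • N := fun t ↦ by
    refine LinearMap.ext fun x ↦ Subtype.ext ?_
    simp only [LinearMap.restrict_apply, hEp_apply, LinearMap.add_apply, Module.End.one_apply,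
      LinearMap.smul_apply, Submodule.coe_add, Submodule.coe_smul, hN]
  have hEm_restrict : ∀ t : ℂ, (Em t).restrict (hEmU t) = 1 - t • N := fun t ↦ by
    refine LinearMap.ext fun x ↦ Subtype.ext ?_
    simp only [LinearMap.restrict_apply, hEm_apply, LinearMap.sub_apply, Module.End.one_apply,
      LinearMap.smul_apply, Submodule.coe_sub, Submodule.coe_smul, hN]
  -- bad parameters, part 1: `1 ± t w` singular — finitely many
  set G : Set ℂ := {t | Function.Injective (Ep t) ∧ Function.Injective (Em t)} with hG
  have heig : Set.Finite {μ : ℂ | w.HasEigenvalue μ} := w.finite_hasEigenvalue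
  have hGc : Gᶜ ⊆ (fun μ : ℂ ↦ -μ⁻¹) '' {μ : ℂ | w.HasEigenvalue μ} ∪
      (fun μ : ℂ ↦ μ⁻¹) '' {μ : ℂ | w.HasEigenvalue μ} := by
    intro t ht
    rw [Set.mem_compl_iff, hG, Set.mem_setOf_eq, not_and_or] at ht
    rcases ht with ht | ht
    · rw [injective_iff_map_eq_zero] at ht
      push Not at ht
      obtain ⟨v, hv, hv0⟩ := ht
      rw [hEp_apply] at hv
      have ht0 : t ≠ 0 := by
        rintro rfl
        rw [zero_smul, add_zero] at hv
        exact hv0 hv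
      have hwv : w v = (-t⁻¹) • v := by
        have : t • w v = -v := eq_neg_of_add_eq_zero_right hv
        calc w v = t⁻¹ • (t • w v) := by rw [smul_smul, inv_mul_cancel₀ ht0, one_smul]
          _ = (-t⁻¹) • v := by rw [this, smul_neg, neg_smul]
      refine Or.inl ⟨-t⁻¹, ?_, by simp⟩
      exact Module.End.hasEigenvalue_of_hasEigenvector ⟨Module.End.mem_eigenspace_iff.2 hwv, hv0⟩
    · rw [injective_iff_map_eq_zero] at ht
      push Not at ht
      obtain ⟨v, hv, hv0⟩ := ht
      rw [hEm_apply] at hv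
      have ht0 : t ≠ 0 := by
        rintro rfl
        rw [zero_smul, sub_zero] at hv
        exact hv0 hv
      have hwv : w v = t⁻¹ • v := by
        have : t • w v = v := (sub_eq_zero.1 hv).symm
        calc w v = t⁻¹ • (t • w v) := by rw [smul_smul, inv_mul_cancel₀ ht0, one_smul]
          _ = t⁻¹ • v := by rw [this]
      refine Or.inr ⟨t⁻¹, ?_, by simp⟩
      exact Module.End.hasEigenvalue_of_hasEigenvector ⟨Module.End.mem_eigenspace_iff.2 hwv, hv0⟩
  have hGcfin : Gᶜ.Finite := ((heig.image _).union (heig.image _)).subset hGc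
  -- bad parameters, part 2: `det(1 + tN) = det(1 - tN)` — finitely many since `Tr N ≠ 0`
  set Bad : Set ℂ := {t | LinearMap.det (1 + t • N) = LinearMap.det (1 - t • N)} with hBad
  have hBadfin : Bad.Finite := by
    by_contra hBinf
    exact htr (trace_eq_zero_of_infinite_det_eq N hBinf)
  -- a good parameter
  obtain ⟨t, ht⟩ : ((Gᶜ ∪ Bad)ᶜ : Set ℂ).Nonempty := (hGcfin.union hBadfin).infinite_compl.nonempty
  rw [Set.compl_union, compl_compl] at ht
  obtain ⟨⟨hinjp, hinjm⟩, htBad⟩ := ht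
  -- the Cayley element
  set e : V ≃ₗ[ℂ] V := LinearEquiv.ofInjectiveEndo (Em t) hinjm with he
  have he_apply : ∀ x, e x = Em t x := fun x ↦ by rw [he, LinearEquiv.coe_ofInjectiveEndo]
  set z : V ≃ₗ[ℂ] V := LinearEquiv.ofInjectiveEndo (Ep t) hinjp * e⁻¹ with hzdef
  have hz_apply : ∀ x, z x = Ep t (e.symm x) := fun x ↦ rfl
  have hz_Em : ∀ x, z (Em t x) = Ep t x := fun x ↦ by
    rw [hz_apply]
    congr 1
    rw [LinearEquiv.symm_apply_eq, he_apply]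
  -- commuting with `w` gives commuting with `z`
  have comm_z : ∀ (P : Module.End ℂ V), (∀ x, P (w x) = w (P x)) → ∀ x, z (P x) = P (z x) := by
    intro P hP x
    have hPEm : ∀ y, P (Em t y) = Em t (P y) := fun y ↦ by
      rw [hEm_apply, hEm_apply, map_sub, map_smul, hP]
    have hPEp : ∀ y, P (Ep t y) = Ep t (P y) := fun y ↦ by
      rw [hEp_apply, hEp_apply, map_add, map_smul, hP]
    have heP : ∀ y, e (P y) = P (e y) := fun y ↦ by rw [he_apply, he_apply, hPEm]
    rw [hz_apply, hz_apply, symm_apply_comm heP, hPEp]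
  -- `z` preserves `B`
  have hEpm : ∀ (x y : V), B (Ep t x) (Ep t y) = B (Em t x) (Em t y) := by
    intro x y
    simp only [hEp_apply, hEm_apply, map_add, map_sub, map_smul, LinearMap.add_apply, LinearMap.sub_apply,
      LinearMap.smul_apply, smul_eq_mul, hskew x]
    ring
  have hzB : ∀ x y, B (z x) (z y) = B x y := by
    intro x y
    obtain ⟨x', rfl⟩ : ∃ x', x = Em t x' := ⟨e.symm x, by rw [← he_apply, e.apply_symm_apply]⟩
    obtain ⟨y', rfl⟩ : ∃ y', y = Em t y' := ⟨e.symm y, by rw [← he_apply, e.apply_symm_apply]⟩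
    rw [hz_Em, hz_Em, hEpm]
  have hzP : ∀ P ∈ Pset, ∀ x, z (P x) = P (z x) := fun P hP x ↦ comm_z P (hwP P hP) x
  have hzS : z ∈ S := hS z hzP hzB
  have hzc : (⟨z, hzS⟩ : S) ∈ Subgroup.center S := by
    rw [Subgroup.mem_center_iff]
    intro s
    apply Subtype.ext
    rw [Subgroup.coe_mul, Subgroup.coe_mul]
    refine LinearEquiv.ext fun x ↦ ?_
    rw [LinearEquiv.mul_apply, LinearEquiv.mul_apply]
    exact (comm_z ((s : V ≃ₗ[ℂ] V) : Module.End ℂ V) (fun y ↦ hSw s s.2 y) x).symm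
  -- `z` preserves `U`
  have heU_surj : ∀ x ∈ U, ∃ x' ∈ U, Em t x' = x := by
    intro x hx
    have hinj : Function.Injective ((Em t).restrict (hEmU t)) := fun a b hab ↦
      Subtype.ext (hinjm (congrArg Subtype.val hab))
    obtain ⟨x', hx'⟩ := (LinearMap.injective_iff_surjective.1 hinj) ⟨x, hx⟩
    exact ⟨x'.1, x'.2, congrArg Subtype.val hx'⟩
  have hzU : ∀ x ∈ U, (z : V →ₗ[ℂ] V) x ∈ U := by
    intro x hx
    obtain ⟨x', hx', rfl⟩ := heU_surj x hx
    rw [LinearEquiv.coe_coe, hz_Em]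
    exact hEpU t x' hx'
  -- `det(z | U) · det(1 - tN) = det(1 + tN)`
  have hcomp : ((z : V →ₗ[ℂ] V).restrict hzU) ∘ₗ ((Em t).restrict (hEmU t)) = (Ep t).restrict (hEpU t) := by
    refine LinearMap.ext fun x ↦ Subtype.ext ?_
    simp only [LinearMap.comp_apply, LinearMap.restrict_apply, LinearEquiv.coe_coe, hz_Em]
  have hdetmul : LinearMap.det ((z : V →ₗ[ℂ] V).restrict hzU) * LinearMap.det (1 - t • N) =
      LinearMap.det (1 + t • N) := by
    rw [← hEm_restrict, ← hEp_restrict, ← LinearMap.det_comp, hcomp]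
  have hdetEm : LinearMap.det (1 - t • N) ≠ 0 := by
    rw [← hEm_restrict]
    have hinj : Function.Injective ((Em t).restrict (hEmU t)) := fun a b hab ↦
      Subtype.ext (hinjm (congrArg Subtype.val hab))
    have hunit : IsUnit ((Em t).restrict (hEmU t)) :=
      (LinearMap.isUnit_iff_ker_eq_bot _).2 (LinearMap.ker_eq_bot.2 hinj)
    exact ((LinearMap.isUnit_iff_isUnit_det _).1 hunit).ne_zero
  refine ⟨z, hzS, hzc, hzP, hzU, fun h1 ↦ htBad ?_⟩
  rw [h1, one_mul] at hdetmul
  exact hdetmul.symm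

end LinAlg

end LefschetzGroupTheta

/-! ## Part 1. The carrier -/

open CategoryTheory Polynomial
open Literature.AlgebraicTopology.SingularHomology
open Literature.AlgebraicGeometry.Motives
open Literature.AlgebraicGeometry.VanGeemen1994 (pullbackOne hodgeGroupOne mem_hodgeGroupOne_iff hodgeClassSpan
  detOnEigenspace)
open Literature.AlgebraicGeometry.Milne1999 (centralizerAlgebra centralizerGroup unitaryCentralizerGroup
  mem_centralizerGroup_iff mem_centralizerAlgebra_iff' centralizerAlgebra_eq_centralizer_span
  hodgeGroupOne_le_unitaryCentralizerGroup unitaryCentralizerGroup_le_centralizerGroup)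
open Literature.Barriers.HodgeConjecture (divisorClassesSpan)
open Literature.Geometry.Kaehler (HasHardLefschetzProperty)

variable {A : AbelianVariety ℂ} {h : complexBetti A.X 2} {φ : A ⟶ A} {P : Polynomial ℤ} {e m : ℕ}

/-- The polarization form `B = coord ∘ Q_h` of a polarization class (private packaging of Part 1 of
`HodgeGroupSemisimpleOfNoTypeIVFactor`). [cite: VoisinHodgeI2002, Thm. 6.32 and §7.1.2] -/
private theorem exists_polarizationForm (h1 : 1 ≤ A.dim) (hQ : IsRationalClass h)
    (h11 : IsOfHodgeType A.dim A.X 2 1 1 h) (hHL : HasHardLefschetzProperty h A.dim) :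
    ∃ B : LinearMap.BilinForm ℂ (complexBetti A.X 1),
      (∀ x y, B y x = -B x y) ∧ B.Nondegenerate ∧
      (∀ w ∈ hodgeGroupOne A.dim A.X, ∀ x y : complexBetti A.X 1, B (w x) (w y) = B x y) ∧
      (∀ x y x' y' : complexBetti A.X 1, B x y = B x' y' ↔
        polarizationPairingOne A.X h (A.dim - 1) x y = polarizationPairingOne A.X h (A.dim - 1) x' y') := by
  obtain ⟨coord, hci, -⟩ := HodgeGroupSemisimple.exists_coord (A := A) h1
  set Q := polarizationPairingOne A.X h (A.dim - 1) with hQdef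
  set B : LinearMap.BilinForm ℂ (complexBetti A.X 1) := Q.compr₂ coord with hBdef
  have hBapply : ∀ x y, B x y = coord (Q x y) := fun x y ↦ rfl
  have hc0 : ∀ w, coord w = 0 → w = 0 := fun w hw ↦ hci (by rw [hw, map_zero])
  have hBalt : ∀ x y, B y x = -B x y := fun x y ↦ by
    rw [hBapply, hBapply, hQdef, polarizationPairingOne_swap, map_neg]
  have hBnd : B.Nondegenerate := by
    refine ⟨fun x hx ↦ ?_, fun y hy ↦ ?_⟩
    · exact Milne1999.eq_zero_of_forall_polarizationPairingOne_eq_zero_of_hasHardLefschetzProperty h1 hHL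
        fun y ↦ hc0 _ (hx y)
    · refine Milne1999.eq_zero_of_forall_polarizationPairingOne_eq_zero_of_hasHardLefschetzProperty h1 hHL
        fun x ↦ ?_
      have e := hc0 _ (hy x)
      rw [hQdef] at e
      rw [polarizationPairingOne_swap, e, neg_zero]
  refine ⟨B, hBalt, hBnd, fun w hw x y ↦ ?_,
    fun x y x' y' ↦ ⟨fun e ↦ hci e, fun e ↦ by rw [hBapply, hBapply, hQdef, e]⟩⟩
  rw [hBapply, hBapply, hQdef, (Milne1999.hodgeGroupOne_le_unitaryCentralizerGroup_of_isRationalClass hQ h11 hw).2 x y]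

/-! ### §1 The adjoint of a central pull-back commutes with the pull-backs; `w = u^* - (u^*)†` preserves `V_ρ` -/

/-- **«`C(A)` is stable under the involution `†`»** (Milne §1 p. 643), for the `Q_h`-adjoint `Y'` of a CENTRAL
pull-back `u^*` (`u^* ∈ C(A) ⊗ ℂ`) and a polarization class `h`: `Y'` commutes with every pull-back `φ^*`.
Proof on the carrier: the adjoint `P'` of `φ^*` commutes with `Hg(A)(ℂ)|_{H¹}` (isometries of `Q_h` commuting
with `φ^*`), hence lies in the span of the pull-backs (Deligne I 3.4 + Riemann, the tree's
`Deligne1982.mem_span_complexBetti_map_of_commute_hodgeGroup`); `u^*` commutes with `P'`; taking adjoints,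
`Y'` commutes with `φ^*`. [cite: Milne1999LefschetzClasses, §1 pp. 642–643] [cite: Deligne1982HodgeCycles, I §3, Prop. 3.4] -/
theorem adjoint_central_pullbackOne_comm_pullbackOne (h1 : 1 ≤ A.dim) (hQ : IsRationalClass h)
    (h11 : IsOfHodgeType A.dim A.X 2 1 1 h) (hHL : HasHardLefschetzProperty h A.dim)
    {u : A ⟶ A} (huC : pullbackOne A u ∈ centralizerAlgebra A) {Y' : Module.End ℂ (complexBetti A.X 1)}
    (hY' : ∀ x y : complexBetti A.X 1, polarizationPairingOne A.X h (A.dim - 1) (pullbackOne A u x) y =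
      polarizationPairingOne A.X h (A.dim - 1) x (Y' y))
    (ψ : A ⟶ A) (x : complexBetti A.X 1) : pullbackOne A ψ (Y' x) = Y' (pullbackOne A ψ x) := by
  haveI : FiniteDimensional ℂ (complexBetti A.X 1) := finite_complexBetti_abelianVariety A 1
  obtain ⟨B, hBalt, hBnd, hBinv, hBQ⟩ := exists_polarizationForm h1 hQ h11 hHL
  set Y := pullbackOne A u with hYdef
  have hadj' : ∀ x y, B (Y x) y = B x (Y' y) := fun x y ↦ (hBQ _ _ _ _).2 (hY' x y)
  have hadj : ∀ x y, B (Y' x) y = B x (Y y) := LefschetzGroupTheta.isAdj_apply_right hBalt hadj'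
  set Pψ := pullbackOne A ψ with hPdef
  set P' := B.leftAdjointOfNondegenerate hBnd Pψ with hP'def
  have hPadj : ∀ x y, B (P' x) y = B x (Pψ y) := fun x y ↦ B.isAdjointPairLeftAdjointOfNondegenerate hBnd Pψ x y
  have hPadj' : ∀ x y, B (Pψ x) y = B x (P' y) := LefschetzGroupTheta.isAdj_apply_right hBalt hPadj
  have hP'g : ∀ g ∈ hodgeGroup A.dim A.X, ∀ y : complexBetti A.X 1, P' (g 1 y) = g 1 (P' y) := by
    intro g hg y
    have hg1 : g 1 ∈ hodgeGroupOne A.dim A.X := mem_hodgeGroupOne_iff.2 ⟨g, hg, rfl⟩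
    exact (LefschetzGroupTheta.isAdj_comm_of_isometry hBnd hPadj (hBinv _ hg1)
      (fun x ↦ hodgeGroupOne_comm_pullbackOne hg1 ψ x) y).symm
  have hP'span : P' ∈ Submodule.span ℂ (Set.range fun χ : A ⟶ A ↦ pullbackOne A χ) :=
    Deligne1982.mem_span_complexBetti_map_of_commute_hodgeGroup A P' hP'g
  have hYc : Y ∈ Subalgebra.centralizer ℂ
      (Submodule.span ℂ (Set.range fun χ : A ⟶ A ↦ pullbackOne A χ) : Set (Module.End ℂ (complexBetti A.X 1))) := by
    rw [← centralizerAlgebra_eq_centralizer_span]; exact huC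
  have hYP' : P' * Y = Y * P' := (Subalgebra.mem_centralizer_iff ℂ).1 hYc P' hP'span
  have key : ∀ y, B (Pψ (Y' x) - Y' (Pψ x)) y = 0 := fun y ↦ by
    rw [map_sub, LinearMap.sub_apply, hPadj', hadj, hadj, hPadj', ← Module.End.mul_apply, ← hYP',
      Module.End.mul_apply, sub_self]
  exact sub_eq_zero.1 (hBnd.1 _ key)

/-- **`w = u^* - (u^*)†` preserves every eigenspace `V_ρ` of `φ^*`** (it commutes with `φ^*`: `u^*` is in
`C(A) ⊗ ℂ` and so is its adjoint). [cite: Milne1999LefschetzClasses, §1 p. 643]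
[cite: MoonenZarhin1998WeilClasses, §1 proof of Criterion (2) («θ : E₋ ↪ End_F(V_X)»)] -/
theorem sub_adjoint_mapsTo_eigenspace (h1 : 1 ≤ A.dim) (hQ : IsRationalClass h)
    (h11 : IsOfHodgeType A.dim A.X 2 1 1 h) (hHL : HasHardLefschetzProperty h A.dim)
    {u : A ⟶ A} (huC : pullbackOne A u ∈ centralizerAlgebra A) {Y' : Module.End ℂ (complexBetti A.X 1)}
    (hY' : ∀ x y : complexBetti A.X 1, polarizationPairingOne A.X h (A.dim - 1) (pullbackOne A u x) y =
      polarizationPairingOne A.X h (A.dim - 1) x (Y' y)) (φ : A ⟶ A) (ρ : ℂ) :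
    ∀ x ∈ Module.End.eigenspace (pullbackOne A φ) ρ,
      (pullbackOne A u - Y') x ∈ Module.End.eigenspace (pullbackOne A φ) ρ := by
  intro x hx
  rw [Module.End.mem_eigenspace_iff] at hx ⊢
  rw [LinearMap.sub_apply, map_sub, ← (mem_centralizerAlgebra_iff'.1 huC) φ x,
    adjoint_central_pullbackOne_comm_pullbackOne h1 hQ h11 hHL huC hY' φ x, hx, map_smul, map_smul, smul_sub]

/-! ### §2 `θ_ρ ≠ 0` ⟹ a central element of `S(A)(h)(ℂ)` with `det ≠ 1` on `V_ρ` -/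

/-- **«The induced map on Lie algebras `θ` … is non-zero» ⟹ the centre of `G_div` acts non-trivially on
`⋀ V_ρ`**, on the carrier and for every `A`: let `h` be a polarization class, `u^*` a central pull-back with
`Q_h`-adjoint `Y'`, `w = u^* - Y'` (an element of `E₋ ⊗ ℂ`), `ρ ∈ ℂ`. If `Tr(w | V_ρ) ≠ 0` (`V_ρ = ker(φ^* - ρ)`),
there is a CENTRAL element `z` of Milne's `S(A)(h)(ℂ)` (`= G_div(X)(ℂ)` when `B = End⁰(X)`, e.g. in the
print's type-4 case `d ≥ 2` or `m ≥ 2`; a subgroup of it in general) with `det(z | V_ρ) ≠ 1` — a Cayley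
transform `(1 + t w)(1 - t w)⁻¹`, `det(z_t | V_ρ) = det(1 + tw|V_ρ)/det(1 - tw|V_ρ) ≢ 1` since the
`t`-coefficients are `± Tr(w | V_ρ)`. [cite: MoonenZarhin1998WeilClasses, §1 Criterion (2), proof of the type-4 case (chunk p0003) and Lemma (1)]
[cite: Milne1999LefschetzClasses, §1 pp. 642–644] -/
theorem exists_mem_center_unitaryCentralizerGroup_detOnEigenspace_ne_one (h1 : 1 ≤ A.dim)
    (hQ : IsRationalClass h) (h11 : IsOfHodgeType A.dim A.X 2 1 1 h) (hHL : HasHardLefschetzProperty h A.dim)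
    {u : A ⟶ A} (huC : pullbackOne A u ∈ centralizerAlgebra A) {Y' : Module.End ℂ (complexBetti A.X 1)}
    (hY' : ∀ x y : complexBetti A.X 1, polarizationPairingOne A.X h (A.dim - 1) (pullbackOne A u x) y =
      polarizationPairingOne A.X h (A.dim - 1) x (Y' y))
    {ρ : ℂ} (hw : ∀ x ∈ Module.End.eigenspace (pullbackOne A φ) ρ,
      (pullbackOne A u - Y') x ∈ Module.End.eigenspace (pullbackOne A φ) ρ)
    (htr : LinearMap.trace ℂ _ ((pullbackOne A u - Y').restrict hw) ≠ 0) :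
    ∃ (z : complexBetti A.X 1 ≃ₗ[ℂ] complexBetti A.X 1) (hz : z ∈ unitaryCentralizerGroup A h),
      (⟨z, hz⟩ : unitaryCentralizerGroup A h) ∈ Subgroup.center (unitaryCentralizerGroup A h) ∧
      detOnEigenspace z (pullbackOne A φ) (hz.1 φ) ρ ≠ 1 := by
  classical
  haveI : FiniteDimensional ℂ (complexBetti A.X 1) := finite_complexBetti_abelianVariety A 1
  obtain ⟨B, hBalt, hBnd, hBinv, hBQ⟩ := exists_polarizationForm h1 hQ h11 hHL
  set Y := pullbackOne A u with hYdef
  have hadj' : ∀ x y, B (Y x) y = B x (Y' y) := fun x y ↦ (hBQ _ _ _ _).2 (hY' x y)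
  have hadj : ∀ x y, B (Y' x) y = B x (Y y) := LefschetzGroupTheta.isAdj_apply_right hBalt hadj'
  set w : Module.End ℂ (complexBetti A.X 1) := Y - Y' with hwdef
  have hskew : ∀ x y, B (w x) y = -B x (w y) := fun x y ↦ by
    simp only [hwdef, LinearMap.sub_apply, map_sub, LinearMap.sub_apply, hadj', hadj]
    ring
  have hYφ : ∀ (ψ : A ⟶ A) (x : complexBetti A.X 1), pullbackOne A ψ (Y x) = Y (pullbackOne A ψ x) :=
    fun ψ x ↦ ((mem_centralizerAlgebra_iff'.1 huC) ψ x).symm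
  have hY'φ : ∀ (ψ : A ⟶ A) (x : complexBetti A.X 1), pullbackOne A ψ (Y' x) = Y' (pullbackOne A ψ x) :=
    fun ψ x ↦ adjoint_central_pullbackOne_comm_pullbackOne h1 hQ h11 hHL huC hY' ψ x
  have hwφ : ∀ Q' ∈ Set.range (fun ψ : A ⟶ A ↦ pullbackOne A ψ), ∀ x, Q' (w x) = w (Q' x) := by
    rintro _ ⟨ψ, rfl⟩ x
    rw [hwdef, LinearMap.sub_apply, LinearMap.sub_apply, map_sub, hYφ, hY'φ]
  have hSw : ∀ s ∈ unitaryCentralizerGroup A h, ∀ x : complexBetti A.X 1, s (w x) = w (s x) := by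
    intro s hs x
    have hsB : ∀ x y, B (s x) (s y) = B x y := fun x y ↦ (hBQ _ _ _ _).2 (hs.2 x y)
    have hsY : ∀ x, s (Y x) = Y (s x) := fun x ↦ mem_centralizerGroup_iff.1 hs.1 u x
    have hsY' : ∀ x, s (Y' x) = Y' (s x) := LefschetzGroupTheta.isAdj_comm_of_isometry hBnd hadj hsB hsY
    rw [hwdef, LinearMap.sub_apply, LinearMap.sub_apply, map_sub, hsY, hsY']
  have hS : ∀ v : complexBetti A.X 1 ≃ₗ[ℂ] complexBetti A.X 1,
      (∀ Q' ∈ Set.range (fun ψ : A ⟶ A ↦ pullbackOne A ψ), ∀ x, v (Q' x) = Q' (v x)) →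
      (∀ x y, B (v x) (v y) = B x y) → v ∈ unitaryCentralizerGroup A h := by
    intro v hvP hvB
    exact ⟨mem_centralizerGroup_iff.2 fun ψ x ↦ hvP _ ⟨ψ, rfl⟩ x, fun x y ↦ (hBQ _ _ _ _).1 (hvB x y)⟩
  obtain ⟨z, hzS, hzc, hzP, hzU, hdet⟩ := LefschetzGroupTheta.exists_mem_center_det_restrict_ne_one hskew _ hwφ
    _ hSw hS (Module.End.eigenspace (pullbackOne A φ) ρ) hw htr
  refine ⟨z, hzS, hzc, ?_⟩
  unfold detOnEigenspace
  exact hdet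

/-! ### §3 Criterion (2), the type-4 direction: `θ_ρ ≠ 0` ⟹ all non-zero Weil classes are exceptional -/

/-- **MOONEN–ZARHIN 1998, CRITERION (2) — «`θ ≠ 0` ⟹ all non-zero classes in `W_F` are exceptional», ON THE
CARRIER, FOR EVERY COMPLEX ABELIAN VARIETY** (no type hypothesis): `φ ∈ End(A)` with `P(φ) = 0`, `P` monic
irreducible of degree `e`, `e · 2m = 2 dim A`, `m ≠ 0`; `h` a polarization class; `u^*` a central pull-back with
`Q_h`-adjoint `Y'` and `w = u^* - Y'`.  If `Tr(w | V_ρ) ≠ 0` for some complex root `ρ` of `P` — the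
complexification at `σ ↔ ρ` of `θ(α) = Tr_F(α; V_X) ≠ 0` — then `W_F ⊗ ℂ ⊓ Dᵐ ⊗ ℂ = ⊥`: a central
`z ∈ S(A)(h)(ℂ)` has `det(z | V_ρ) ≠ 1` (§2), so `S(A)(h)(ℂ) ⊆ G_div(X)(ℂ)` does not act trivially on `W_F` and
`W_F ⊄ 𝒟` (the tree's `weilClassesField_inf_divisorClassesSpan_eq_bot_iff_exists_detOnEigenspace_ne_one`,
Milne's invariant theory of `S(A)`); the conclusion does not depend on the reading of `G_div`.
[cite: MoonenZarhin1998WeilClasses, §1 Criterion (2) (type 4 case) and its proof (chunks p0003–p0004)]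
[cite: Milne1999LefschetzClasses, Thm. 3.2, Cor. 4.5] -/
theorem weilClassesField_inf_divisorClassesSpan_eq_bot_of_trace_ne_zero (h1 : 1 ≤ A.dim)
    (hQ : IsRationalClass h) (h11 : IsOfHodgeType A.dim A.X 2 1 1 h) (hHL : HasHardLefschetzProperty h A.dim)
    (hPm : P.Monic) (hPe : P.natDegree = e) (hPirr : Irreducible (P.map (Int.castRingHom ℚ)))
    (hφ : Polynomial.eval₂ (Int.castRingHom (CategoryTheory.End A)) (φ : CategoryTheory.End A) P = 0)
    (her : e * (2 * m) = 2 * A.dim) (hm : m ≠ 0)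
    {u : A ⟶ A} (huC : pullbackOne A u ∈ centralizerAlgebra A) {Y' : Module.End ℂ (complexBetti A.X 1)}
    (hY' : ∀ x y : complexBetti A.X 1, polarizationPairingOne A.X h (A.dim - 1) (pullbackOne A u x) y =
      polarizationPairingOne A.X h (A.dim - 1) x (Y' y))
    {ρ : ℂ} (hρ : Polynomial.eval₂ (Int.castRingHom ℂ) ρ P = 0)
    (hw : ∀ x ∈ Module.End.eigenspace (pullbackOne A φ) ρ,
      (pullbackOne A u - Y') x ∈ Module.End.eigenspace (pullbackOne A φ) ρ)
    (htr : LinearMap.trace ℂ _ ((pullbackOne A u - Y').restrict hw) ≠ 0) :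
    weilClassesField A φ P (2 * m) ⊓ divisorClassesSpan A.X A.dim m = ⊥ := by
  have hh : h ∈ hodgeClassSpan A.dim A.X 1 := Submodule.subset_span
    (show h ∈ {c : complexBetti A.X (2 * 1) | IsRationalClass c ∧ IsOfHodgeType A.dim A.X (2 * 1) 1 1 c}
      from ⟨hQ, h11⟩)
  have hnd : ∀ x : complexBetti A.X 1, (∀ y, polarizationPairingOne A.X h (A.dim - 1) x y = 0) → x = 0 :=
    fun x hx ↦ Milne1999.eq_zero_of_forall_polarizationPairingOne_eq_zero_of_hasHardLefschetzProperty h1 hHL hx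
  obtain ⟨z, hz, -, hdet⟩ :=
    exists_mem_center_unitaryCentralizerGroup_detOnEigenspace_ne_one (φ := φ) h1 hQ h11 hHL huC hY' hw htr
  exact (weilClassesField_inf_divisorClassesSpan_eq_bot_iff_exists_detOnEigenspace_ne_one hPm hPe hPirr hφ her hm
    hh hnd).2 ⟨z, hz, ρ, hρ, hdet⟩

/-- **The same, with the adjoint supplied by the theorem** (every endomorphism of `H¹(A(ℂ); ℂ)` has a unique
`Q_h`-adjoint for a polarization class): if for some central `u` and some root `ρ` EVERY `Q_h`-adjoint `Y'` of
`u^*` gives `Tr((u^* - Y') | V_ρ) ≠ 0`, then `W_F ⊗ ℂ ⊓ Dᵐ ⊗ ℂ = ⊥`.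
[cite: MoonenZarhin1998WeilClasses, §1 Criterion (2) (type 4 case) and its proof (chunks p0003–p0004)] -/
theorem weilClassesField_inf_divisorClassesSpan_eq_bot_of_forall_adjoint_trace_ne_zero (h1 : 1 ≤ A.dim)
    (hQ : IsRationalClass h) (h11 : IsOfHodgeType A.dim A.X 2 1 1 h) (hHL : HasHardLefschetzProperty h A.dim)
    (hPm : P.Monic) (hPe : P.natDegree = e) (hPirr : Irreducible (P.map (Int.castRingHom ℚ)))
    (hφ : Polynomial.eval₂ (Int.castRingHom (CategoryTheory.End A)) (φ : CategoryTheory.End A) P = 0)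
    (her : e * (2 * m) = 2 * A.dim) (hm : m ≠ 0)
    {u : A ⟶ A} (huC : pullbackOne A u ∈ centralizerAlgebra A) {ρ : ℂ}
    (hρ : Polynomial.eval₂ (Int.castRingHom ℂ) ρ P = 0)
    (htr : ∀ (Y' : Module.End ℂ (complexBetti A.X 1))
      (hY' : ∀ x y : complexBetti A.X 1, polarizationPairingOne A.X h (A.dim - 1) (pullbackOne A u x) y =
        polarizationPairingOne A.X h (A.dim - 1) x (Y' y)),
      LinearMap.trace ℂ _ ((pullbackOne A u - Y').restrict
        (sub_adjoint_mapsTo_eigenspace h1 hQ h11 hHL huC hY' φ ρ)) ≠ 0) :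
    weilClassesField A φ P (2 * m) ⊓ divisorClassesSpan A.X A.dim m = ⊥ := by
  have hnd : ∀ x : complexBetti A.X 1, (∀ y, polarizationPairingOne A.X h (A.dim - 1) x y = 0) → x = 0 :=
    fun x hx ↦ Milne1999.eq_zero_of_forall_polarizationPairingOne_eq_zero_of_hasHardLefschetzProperty h1 hHL hx
  obtain ⟨Y', hY'⟩ := Milne1999.exists_adjoint_polarizationPairingOne hnd (pullbackOne A u)
  exact weilClassesField_inf_divisorClassesSpan_eq_bot_of_trace_ne_zero h1 hQ h11 hHL hPm hPe hPirr hφ her hm huC hY'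
    hρ (sub_adjoint_mapsTo_eigenspace h1 hQ h11 hHL huC hY' φ ρ) (htr Y' hY')

/-! ### §4 (rider) «`C(A)` is stable under the involution `†`» for the centre part `E ⊗ ℂ`, in full -/

/-- **The `Q_h`-adjoint of a central pull-back commutes with every pull-back, i.e. lies in `C(A) ⊗ ℂ`**
(`centralizerAlgebra A`) — §1 restated as a membership. [cite: Milne1999LefschetzClasses, §1 pp. 642–643 («C(A) is a k-algebra stable under the involution †»)] -/
theorem adjoint_central_pullbackOne_mem_centralizerAlgebra (h1 : 1 ≤ A.dim) (hQ : IsRationalClass h)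
    (h11 : IsOfHodgeType A.dim A.X 2 1 1 h) (hHL : HasHardLefschetzProperty h A.dim)
    {u : A ⟶ A} (huC : pullbackOne A u ∈ centralizerAlgebra A) {Y' : Module.End ℂ (complexBetti A.X 1)}
    (hY' : ∀ x y : complexBetti A.X 1, polarizationPairingOne A.X h (A.dim - 1) (pullbackOne A u x) y =
      polarizationPairingOne A.X h (A.dim - 1) x (Y' y)) :
    Y' ∈ centralizerAlgebra A :=
  mem_centralizerAlgebra_iff'.2 fun ψ x ↦ (adjoint_central_pullbackOne_comm_pullbackOne h1 hQ h11 hHL huC hY' ψ x).symm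

/-- **«`C(A)` is stable under `†`», the centre part in full: the `Q_h`-adjoint of a central pull-back is a
`ℂ`-combination of CENTRAL pull-backs** (`E ⊗ ℂ` on `H¹` is `†`-stable), for a polarization class `h`: `Y'`
commutes with `Hg(A)(ℂ)|_{H¹}` (isometries of `Q_h` commuting with `u^*`) and with every `φ^*` (§1), hence
lies in the span of the central pull-backs (the tree's `HodgeGroupSemisimple.mem_span_pullbackOne_of_commute`:
Deligne I 3.4 + Riemann). So `w = u^* - (u^*)† ∈ E₋ ⊗ ℂ` is itself a combination of central pull-backs.
[cite: Milne1999LefschetzClasses, §1 pp. 642–643] [cite: Deligne1982HodgeCycles, I §3 Prop. 3.4]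
[cite: MoonenZarhin1998WeilClasses, §1 proof of Criterion (2) («θ : E₋ ↪ End_F(V_X)»)] -/
theorem adjoint_central_pullbackOne_mem_span_central_pullbackOne (h1 : 1 ≤ A.dim) (hQ : IsRationalClass h)
    (h11 : IsOfHodgeType A.dim A.X 2 1 1 h) (hHL : HasHardLefschetzProperty h A.dim)
    {u : A ⟶ A} (huC : pullbackOne A u ∈ centralizerAlgebra A) {Y' : Module.End ℂ (complexBetti A.X 1)}
    (hY' : ∀ x y : complexBetti A.X 1, polarizationPairingOne A.X h (A.dim - 1) (pullbackOne A u x) y =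
      polarizationPairingOne A.X h (A.dim - 1) x (Y' y)) :
    Y' ∈ Submodule.span ℂ {Y : Module.End ℂ (complexBetti A.X 1) |
      ∃ v : A ⟶ A, Y = pullbackOne A v ∧ pullbackOne A v ∈ centralizerAlgebra A} := by
  haveI : FiniteDimensional ℂ (complexBetti A.X 1) := finite_complexBetti_abelianVariety A 1
  obtain ⟨B, hBalt, hBnd, hBinv, hBQ⟩ := exists_polarizationForm h1 hQ h11 hHL
  have hadj' : ∀ x y, B (pullbackOne A u x) y = B x (Y' y) := fun x y ↦ (hBQ _ _ _ _).2 (hY' x y)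
  have hadj : ∀ x y, B (Y' x) y = B x (pullbackOne A u y) := LefschetzGroupTheta.isAdj_apply_right hBalt hadj'
  refine HodgeGroupSemisimple.mem_span_pullbackOne_of_commute A Y' (fun g hg y ↦ ?_) fun φ y ↦
    (adjoint_central_pullbackOne_comm_pullbackOne h1 hQ h11 hHL huC hY' φ y).symm
  have hg1 : g 1 ∈ hodgeGroupOne A.dim A.X := mem_hodgeGroupOne_iff.2 ⟨g, hg, rfl⟩
  exact (LefschetzGroupTheta.isAdj_comm_of_isometry hBnd hadj (hBinv _ hg1)
    (fun x ↦ hodgeGroupOne_comm_pullbackOne hg1 u x) y).symm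

/-- **`w = u^* - (u^*)†` is a `ℂ`-combination of central pull-backs** (`E₋ ⊗ ℂ ⊆ E ⊗ ℂ` on the carrier).
[cite: MoonenZarhin1998WeilClasses, §1 proof of Criterion (2) («θ : E₋ ↪ End_F(V_X)»)] [cite: Milne1999LefschetzClasses, §1 pp. 642–643] -/
theorem sub_adjoint_mem_span_central_pullbackOne (h1 : 1 ≤ A.dim) (hQ : IsRationalClass h)
    (h11 : IsOfHodgeType A.dim A.X 2 1 1 h) (hHL : HasHardLefschetzProperty h A.dim)
    {u : A ⟶ A} (huC : pullbackOne A u ∈ centralizerAlgebra A) {Y' : Module.End ℂ (complexBetti A.X 1)}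
    (hY' : ∀ x y : complexBetti A.X 1, polarizationPairingOne A.X h (A.dim - 1) (pullbackOne A u x) y =
      polarizationPairingOne A.X h (A.dim - 1) x (Y' y)) :
    pullbackOne A u - Y' ∈ Submodule.span ℂ {Y : Module.End ℂ (complexBetti A.X 1) |
      ∃ v : A ⟶ A, Y = pullbackOne A v ∧ pullbackOne A v ∈ centralizerAlgebra A} :=
  Submodule.sub_mem _ (Submodule.subset_span ⟨u, rfl, huC⟩)
    (adjoint_central_pullbackOne_mem_span_central_pullbackOne h1 hQ h11 hHL huC hY')

end Literature.AlgebraicGeometry.HodgeTheory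

end
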